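import Summits.Ventures.YMGap.YM3IR.ForestQuasiLocality

/-!
# YM3IR / ForestTransport — pulling cylinder observables back through the leaf rotation (kernel bookkeeping)

HONEST FRAMING.  Support-and-load bookkeeping for the cell's track-Y4 audit of `IRConjecture3` (`YM3IR/Statement.lean`),
forest case: given the forest (star-decimation) block family of `YM3IR/ForestAudit.lean`, the conditional covariance given
the coarse σ-algebra is the plain covariance of the observables PULLED BACK through the leaf rotation
(`ForestDisintegration.lean`: `forestFix`, `leafGauge`); this file records how supports and Dobrushin loads of bounded
cylinder observables change under that pull-back (supports grow by torus distance `≤ 2`, loads by a factor `≤ 3`).  It is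
pure lattice combinatorics plus one change of variables.  NOTHING here is about Yang–Mills dynamics: no mass gap, no
continuum statement, no smallness, no decay estimate, no renormalisation-group content; the block map concerned is NOT
gauge-covariant (theory-1's `YM3IR/CovariantFamily.lean`).  Used by `YM3IR/ForestWitness.lean`.

CONTENT.
* `starLink c` / `blockEdge e` — the fine representative of a coarse link / the coarse link under a fine one;
  `starDecimation_eq_apply_starLink`, `blockEdge_starLink` (`blockOf_liftSite_corner` is a private copy of
  theory-1's `CovariantFamily.blockOf_liftSite`, which this file does not import).
* `fixPull s f := f ∘ gaugeTransform (leafGauge s) ∘ forestFix` and `fixSupport Δ` with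
  `dependsOn_fixPull : DependsOn f Δ → DependsOn (fixPull s f) (fixSupport Δ)`;
  `forestAverage_map_forestFix`, `forestCov_eq_covariance_fixPull` — the forest average / forest covariance under the
  pushed-forward law are the mean / covariance of the pull-backs under the original law.
* `starReads`, `fixLoad Δ δ` with `isLipBound_fixPull` (the pull-back is `r`-Lipschitz with loads `fixLoad`) and
  `sum_fixLoad_le : Σ fixLoad ≤ 3 Σ δ`; `weight_leafGauge_starDecimation_le` (one fine link moves at most the leaf
  rotations reading it).
* `exists_near_of_mem_fixSupport`, `fixSupport_separated : sep(Δf, Δg) ≥ n → sep(fixSupport Δf, fixSupport Δg) ≥ n − 4`.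
Hypotheses on the link weight `r` where needed: bi-invariance, symmetry, `r a a = 0`, triangle inequality.

## References
* H. Föllmer, *Random fields and diffusion processes*, École d\'Été de Saint-Flour XV–XVII (1988), Ch. I Remark (2.17)
  (interpolation bound; tree `DobrushinComparisonMetric.lean`). [cite: Follmer1988, Ch. I Remark (2.17)]
* M. Creutz, *Quarks, Gluons and Lattices* (1983), eq. (9.19); I. Montvay, G. Münster, *Quantum Fields on a Lattice* (1994),
  §3.2.5 (maximal trees / axial gauge: conditioning on a forest is a change of variables).
-/

noncomputable section

open MeasureTheory ProbabilityTheory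
open Literature.MathematicalPhysics.QuantumLattice Literature.MathematicalPhysics.QuantumFieldTheory
open Literature.Probability.LatticeModels Literature.Probability.LatticeModels.DobrushinMetric

namespace Summit.Ventures.YMGap.YM3IR

section ForestTransport

variable {G : Type} [Group G] {b M : ℕ}

/-- The fine STAR LINK carrying the coarse link `c = (y, i)`: `(b·y, i)` (`starDecimation U c = U (starLink c)`). [folklore] -/
def starLink (b M : ℕ) (c : Edge 3 M) : Edge 3 (b * M) := (liftSite b M c.1, c.2)

/-- The coarse link «under» a fine link: block of its base point, same direction. [folklore] -/
def blockEdge (b M : ℕ) (e : Edge 3 (b * M)) : Edge 3 M := (blockOf b M e.1, e.2)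

/-- The star decimation reads the star link of each coarse edge (definitional). [folklore] -/
theorem starDecimation_eq_apply_starLink {K : Type} (U : GaugeConfig 3 (b * M) K) (c : Edge 3 M) :
    starDecimation b M U c = U (starLink b M c) := rfl

/-- The leaf rotation at `x` depends on the forest field only through the star link read at `x`. [folklore] -/
theorem leafGauge_congr_leafLink {s s' : Edge 3 M → G} {x : Site 3 (b * M)}
    (h : ∀ c, leafLink b M x = some c → s c = s' c) : leafGauge b M s x = leafGauge b M s' x := by
  unfold leafLink at h
  unfold leafGauge
  by_cases hx : ∃ i : Fin 3, (x i).val % b = 1 ∧ ∀ j, j ≠ i → (x j).val % b = 0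
  · rw [dif_pos hx, dif_pos hx, h _ (by rw [dif_pos hx])]
  · rw [dif_neg hx, dif_neg hx]

/-- A site reading no star link is not rotated. [folklore] -/
theorem leafGauge_eq_one_of_leafLink_eq_none {s : Edge 3 M → G} {x : Site 3 (b * M)}
    (h : leafLink b M x = none) : leafGauge b M s x = 1 := by
  unfold leafLink at h
  unfold leafGauge
  by_cases hx : ∃ i : Fin 3, (x i).val % b = 1 ∧ ∀ j, j ≠ i → (x j).val % b = 0
  · rw [dif_pos hx] at h; exact absurd h (by simp)
  · rw [dif_neg hx]

/-- **THE PULLED-BACK OBSERVABLE** `F_s := f ∘ Φ_s ∘ γ`: rotate by the leaf gauge of the forest field `s` AFTER the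
forest axial gauge fixing `γ = forestFix`.  `Cov_Wilson(F_s, G_s)` is the forest covariance `forestCov f g s`
(`forestCov_eq_covariance_fixPull`). [folklore] -/
def fixPull (b M : ℕ) (s : GaugeConfig 3 M G) (f : GaugeConfig 3 (b * M) G → ℝ) :
    GaugeConfig 3 (b * M) G → ℝ :=
  fun U => f (gaugeTransform (leafGauge b M s) (forestFix b M U))

/-- The ENLARGED SUPPORT of the pulled-back observable: `Δ` together with the star links read at the endpoints of the
links of `Δ`. [folklore] -/
def fixSupport (b M : ℕ) (Δ : Set (Edge 3 (b * M))) : Set (Edge 3 (b * M)) :=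
  Δ ∪ {e₀ | ∃ e ∈ Δ, ∃ c : Edge 3 M,
    (leafLink b M e.1 = some c ∨ leafLink b M (e.1.shift e.2) = some c) ∧ e₀ = starLink b M c}

/-- A support is contained in its gauge-fixed support. [folklore] -/
theorem subset_fixSupport (Δ : Set (Edge 3 (b * M))) : Δ ⊆ fixSupport b M Δ := Set.subset_union_left

/-- `F_s` depends only on the enlarged support. [folklore] -/
theorem dependsOn_fixPull (s : GaugeConfig 3 M G) {f : GaugeConfig 3 (b * M) G → ℝ} {Δ : Set (Edge 3 (b * M))}
    (hf : DependsOn f Δ) : DependsOn (fixPull b M s f) (fixSupport b M Δ) := by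
  intro U U' hUU'
  refine hf fun e he => ?_
  have hleaf : ∀ x : Site 3 (b * M), (leafLink b M x = none ∨ ∃ c, leafLink b M x = some c ∧
      starLink b M c ∈ fixSupport b M Δ) →
      leafGauge b M (starDecimation b M U)⁻¹ x = leafGauge b M (starDecimation b M U')⁻¹ x := by
    intro x hx
    refine leafGauge_congr_leafLink fun c hc => ?_
    rcases hx with hx | ⟨c', hc', hmem⟩
    · rw [hx] at hc; exact absurd hc (by simp)
    · rw [hc'] at hc
      cases Option.some.inj hc
      simp only [Pi.inv_apply, starDecimation_eq_apply_starLink, hUU' _ hmem]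
  have h1 := hleaf e.1 (by
    cases hc : leafLink b M e.1 with
    | none => exact Or.inl rfl
    | some c => exact Or.inr ⟨c, rfl, Or.inr ⟨e, he, c, Or.inl hc, rfl⟩⟩)
  have h2 := hleaf (e.1.shift e.2) (by
    cases hc : leafLink b M (e.1.shift e.2) with
    | none => exact Or.inl rfl
    | some c => exact Or.inr ⟨c, rfl, Or.inr ⟨e, he, c, Or.inr hc, rfl⟩⟩)
  show leafGauge b M s e.1 * (leafGauge b M (starDecimation b M U)⁻¹ e.1 * U e
      * (leafGauge b M (starDecimation b M U)⁻¹ (e.1.shift e.2))⁻¹) * (leafGauge b M s (e.1.shift e.2))⁻¹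
    = leafGauge b M s e.1 * (leafGauge b M (starDecimation b M U')⁻¹ e.1 * U' e
      * (leafGauge b M (starDecimation b M U')⁻¹ (e.1.shift e.2))⁻¹) * (leafGauge b M s (e.1.shift e.2))⁻¹
  rw [h1, h2, hUU' e (subset_fixSupport Δ he)]

variable {r : G → G → ℝ}

/-- A weight with symmetry, `r a a = 0` and the triangle inequality is non-negative. [folklore] -/
theorem weight_nonneg {K : Type} {r : K → K → ℝ} (hsymm : ∀ a a' : K, r a a' = r a' a)
    (hself : ∀ a : K, r a a = 0) (htri : ∀ a a' a'' : K, r a a'' ≤ r a a' + r a' a'') (a a' : K) :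
    0 ≤ r a a' := by
  have h := htri a a' a
  rw [hself, hsymm a' a] at h
  linarith

/-- Rotating two configurations by the SAME gauge function does not change link distances (bi-invariance). [folklore] -/
theorem weight_gaugeTransform_eq (hmulL : ∀ g a a' : G, r (g * a) (g * a') = r a a')
    (hmulR : ∀ g a a' : G, r (a * g) (a' * g) = r a a') (g : Site 3 (b * M) → G) (a a' : GaugeConfig 3 (b * M) G)
    (e : Edge 3 (b * M)) : r (gaugeTransform g a e) (gaugeTransform g a' e) = r (a e) (a' e) := by
  show r (g e.1 * a e * (g (e.1.shift e.2))⁻¹) (g e.1 * a' e * (g (e.1.shift e.2))⁻¹) = r (a e) (a' e)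
  rw [hmulR, hmulL]

/-- Indicator that the fine link `e₀` is the star link read by the leaf rotation at the site `x`. [folklore] -/
def starReads (b M : ℕ) (e₀ : Edge 3 (b * M)) (x : Site 3 (b * M)) : ℝ :=
  if e₀ = starLink b M (blockEdge b M e₀) ∧ leafLink b M x = some (blockEdge b M e₀) then 1 else 0

/-- The star-read indicator is nonnegative. [folklore] -/
theorem starReads_nonneg (e₀ : Edge 3 (b * M)) (x : Site 3 (b * M)) : 0 ≤ starReads b M e₀ x := by
  unfold starReads; split_ifs <;> norm_num

/-- **THE FINE LOADS OF THE PULLED-BACK OBSERVABLE**: the link `e₀` is charged with its own load (if `e₀ ∈ Δ`) and with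
the loads of every link of `Δ` having an endpoint whose leaf rotation reads `e₀`. [folklore] -/
def fixLoad (b M : ℕ) (Δ : Finset (Edge 3 (b * M))) (δ : Edge 3 (b * M) → ℝ) (e₀ : Edge 3 (b * M)) : ℝ :=
  ∑ e ∈ Δ, δ e * ((if e = e₀ then 1 else 0) + starReads b M e₀ e.1 + starReads b M e₀ (e.1.shift e.2))

/-- Pulled-back loads are nonnegative when the fine loads are. [folklore] -/
theorem fixLoad_nonneg (Δ : Finset (Edge 3 (b * M))) {δ : Edge 3 (b * M) → ℝ} (hδ : ∀ e, 0 ≤ δ e)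
    (e₀ : Edge 3 (b * M)) : 0 ≤ fixLoad b M Δ δ e₀ :=
  Finset.sum_nonneg fun e _ => mul_nonneg (hδ e) (add_nonneg (add_nonneg (by split_ifs <;> norm_num)
    (starReads_nonneg _ _)) (starReads_nonneg _ _))

/-- A shifted site is adjacent to the site. [folklore] -/
theorem torusNorm_shift_sub_le_one (x : Site 3 (b * M)) (i : Fin 3) [NeZero (b * M)] :
    Literature.MathematicalPhysics.QuantumFieldTheory.torusNorm (x.shift i - x) ≤ 1 := by
  refine Finset.sup_le fun j _ => ?_
  have hj : (x.shift i - x) j = (Pi.single i (1 : ZMod (b * M)) : Site 3 (b * M)) j := by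
    simp only [Literature.MathematicalPhysics.QuantumFieldTheory.Site.shift, Pi.sub_apply, Pi.add_apply,
      add_sub_cancel_left]
  rw [hj]
  by_cases hji : j = i
  · subst hji; rw [Pi.single_eq_same]; exact natAbs_valMinAbs_one_le_one
  · rw [Pi.single_eq_of_ne hji, ZMod.valMinAbs_zero]; norm_num

/-- Each site reads at most one star link: `Σ_{e₀} starReads e₀ x ≤ 1`. [folklore] -/
theorem sum_starReads_le_one [NeZero (b * M)] (x : Site 3 (b * M)) :
    ∑ e₀ : Edge 3 (b * M), starReads b M e₀ x ≤ 1 := by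
  classical
  cases hx : leafLink b M x with
  | none =>
    have h : ∀ e₀ : Edge 3 (b * M), starReads b M e₀ x = 0 := fun e₀ => by
      unfold starReads; rw [hx, if_neg (fun h => absurd h.2 (by simp))]
    simp [h]
  | some c =>
    have h : ∀ e₀ : Edge 3 (b * M), e₀ ≠ starLink b M c → starReads b M e₀ x = 0 := fun e₀ he₀ => by
      unfold starReads; rw [hx]
      refine if_neg fun hh => he₀ ?_
      rw [hh.1, ← Option.some.inj hh.2]
    rw [Finset.sum_eq_single_of_mem (starLink b M c) (Finset.mem_univ _) fun e₀ _ he₀ => h e₀ he₀]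
    unfold starReads; split_ifs <;> norm_num

/-- **TOTAL LOAD OF `F_s` ≤ 3 × TOTAL LOAD OF `f`**: each link is charged once for itself and at most once per endpoint.
[folklore] -/
theorem sum_fixLoad_le [NeZero (b * M)] (Δ : Finset (Edge 3 (b * M))) {δ : Edge 3 (b * M) → ℝ}
    (hδ : ∀ e, 0 ≤ δ e) : ∑ e₀ : Edge 3 (b * M), fixLoad b M Δ δ e₀ ≤ 3 * ∑ e ∈ Δ, δ e := by
  classical
  calc ∑ e₀ : Edge 3 (b * M), fixLoad b M Δ δ e₀
      = ∑ e ∈ Δ, δ e * ∑ e₀ : Edge 3 (b * M),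
          ((if e = e₀ then 1 else 0) + starReads b M e₀ e.1 + starReads b M e₀ (e.1.shift e.2)) := by
        simp only [fixLoad, Finset.mul_sum]; exact Finset.sum_comm
    _ ≤ ∑ e ∈ Δ, δ e * 3 := by
        refine Finset.sum_le_sum fun e _ => mul_le_mul_of_nonneg_left ?_ (hδ e)
        rw [Finset.sum_add_distrib, Finset.sum_add_distrib, Finset.sum_ite_eq Finset.univ e, if_pos (Finset.mem_univ _)]
        linarith [sum_starReads_le_one e.1, sum_starReads_le_one (e.1.shift e.2)]
    _ = 3 * ∑ e ∈ Δ, δ e := by rw [← Finset.sum_mul, mul_comm]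

section AnalysisA

variable [MeasurableSpace G] [TopologicalSpace G] [IsTopologicalGroup G] [BorelSpace G]
  [SecondCountableTopology G]

/-- The leaf rotation by a fixed forest configuration is a measurable map of the fine field. [folklore] -/
theorem measurable_gaugeTransform_leafGauge_const (s : GaugeConfig 3 M G) :
    Measurable (fun a : GaugeConfig 3 (b * M) G => gaugeTransform (leafGauge b M s) a) :=
  measurable_gaugeTransform_leafGauge.comp (measurable_id.prodMk measurable_const)

/-- The pull-back of a measurable observable through the leaf rotation is measurable. [folklore] -/
theorem measurable_fixPull {f : GaugeConfig 3 (b * M) G → ℝ} (hfm : Measurable f) (s : GaugeConfig 3 M G) :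
    Measurable (fixPull b M s f) :=
  hfm.comp ((measurable_gaugeTransform_leafGauge_const s).comp measurable_forestFix)

/-- The forest average against the pushed-forward law is the plain average of the pulled-back observable. [folklore] -/
theorem forestAverage_map_forestFix (μ : Measure (GaugeConfig 3 (b * M) G)) {f : GaugeConfig 3 (b * M) G → ℝ}
    (hfm : Measurable f) (s : GaugeConfig 3 M G) :
    forestAverage b M (μ.map (forestFix b M)) f s = ∫ U, fixPull b M s f U ∂μ := by
  unfold forestAverage fixPull
  rw [integral_map measurable_forestFix.aemeasurable]
  exact (hfm.comp (measurable_gaugeTransform_leafGauge_const s)).aestronglyMeasurable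

/-- **THE FOREST COVARIANCE IS A PLAIN COVARIANCE**: `forestCov f g s = Cov_μ(F_s, G_s)` for bounded measurable `f, g` and a
probability law `μ`. [folklore] -/
theorem forestCov_eq_covariance_fixPull (μ : Measure (GaugeConfig 3 (b * M) G)) [IsProbabilityMeasure μ]
    {f g : GaugeConfig 3 (b * M) G → ℝ} (hfm : Measurable f) (hgm : Measurable g) {Cf Cg : ℝ}
    (hCf : ∀ U, |f U| ≤ Cf) (hCg : ∀ U, |g U| ≤ Cg) (s : GaugeConfig 3 M G) :
    forestCov b M (μ.map (forestFix b M)) f g s = cov[fixPull b M s f, fixPull b M s g; μ] := by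
  have hF2 : MemLp (fixPull b M s f) 2 μ := MemLp.of_bound (measurable_fixPull hfm s).aestronglyMeasurable Cf
    (Filter.Eventually.of_forall fun U => by rw [Real.norm_eq_abs]; exact hCf _)
  have hG2 : MemLp (fixPull b M s g) 2 μ := MemLp.of_bound (measurable_fixPull hgm s).aestronglyMeasurable Cg
    (Filter.Eventually.of_forall fun U => by rw [Real.norm_eq_abs]; exact hCg _)
  rw [covariance_eq_sub hF2 hG2, forestCov, forestAverage_map_forestFix μ hfm, forestAverage_map_forestFix μ hgm,
    forestAverage_map_forestFix μ (f := fun U => f U * g U) (hfm.mul hgm)]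
  rfl

end AnalysisA

variable [NeZero M]

/-- `blockOf (liftSite y) = y` — a `private`, renamed copy of theory-1's `CovariantFamily.lean` lemma `blockOf_liftSite`
(one fully-qualified name per tree; this file does not import `CovariantFamily`). [folklore] -/
private theorem blockOf_liftSite_corner (hb : 0 < b) (y : Site 3 M) : blockOf b M (liftSite b M y) = y := by
  haveI : NeZero (b * M) := ⟨Nat.mul_ne_zero hb.ne' (NeZero.ne M)⟩
  funext i
  have hlt : b * (y i).val < b * M := Nat.mul_lt_mul_of_pos_left (ZMod.val_lt _) hb
  simp only [blockOf, liftSite, ZMod.val_natCast, Nat.mod_eq_of_lt hlt, Nat.mul_div_cancel_left _ hb,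
    ZMod.natCast_zmod_val]

/-- The star link of a coarse edge lies over that coarse edge. [folklore] -/
theorem blockEdge_starLink (hb : 0 < b) (c : Edge 3 M) : blockEdge b M (starLink b M c) = c := by
  simp only [blockEdge, starLink, blockOf_liftSite_corner hb]

/-- The leaf rotations built from two configurations that agree off `e₀` differ at `x` by at most `r(U e₀, U' e₀)`, and
only if `x` reads `e₀`. [folklore] -/
theorem weight_leafGauge_starDecimation_le (hb : 0 < b) (hsymm : ∀ a a' : G, r a a' = r a' a)
    (hself : ∀ a : G, r a a = 0) (htri : ∀ a a' a'' : G, r a a'' ≤ r a a' + r a' a'')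
    {U U' : GaugeConfig 3 (b * M) G} {e₀ : Edge 3 (b * M)} (hUU' : ∀ z, z ≠ e₀ → U z = U' z) (x : Site 3 (b * M)) :
    r (leafGauge b M (starDecimation b M U)⁻¹ x) (leafGauge b M (starDecimation b M U')⁻¹ x)
      ≤ starReads b M e₀ x * r (U e₀) (U' e₀) := by
  have h0 : 0 ≤ starReads b M e₀ x * r (U e₀) (U' e₀) :=
    mul_nonneg (starReads_nonneg e₀ x) (weight_nonneg hsymm hself htri _ _)
  cases hx : leafLink b M x with
  | none => rw [leafGauge_eq_one_of_leafLink_eq_none hx, leafGauge_eq_one_of_leafLink_eq_none hx, hself]; exact h0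
  | some c =>
    rw [leafGauge_eq_of_leafLink_eq_some hx, leafGauge_eq_of_leafLink_eq_some hx]
    simp only [Pi.inv_apply, inv_inv, starDecimation_eq_apply_starLink]
    by_cases hc : starLink b M c = e₀
    · subst hc
      have h1 : starReads b M (starLink b M c) x = 1 := by
        unfold starReads; rw [if_pos ⟨by rw [blockEdge_starLink hb], by rw [blockEdge_starLink hb, hx]⟩]
      rw [h1, one_mul]
    · rw [hUU' _ hc, hself]; exact h0

/-- **`F_s` IS COORDINATEWISE `r`-LIPSCHITZ WITH LOADS `fixLoad`** (bi-invariant symmetric `r` with `r a a = 0` and the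
triangle inequality). [folklore] -/
theorem isLipBound_fixPull (hb : 0 < b) (hmulL : ∀ g a a' : G, r (g * a) (g * a') = r a a')
    (hmulR : ∀ g a a' : G, r (a * g) (a' * g) = r a a') (hsymm : ∀ a a' : G, r a a' = r a' a)
    (hself : ∀ a : G, r a a = 0) (htri : ∀ a a' a'' : G, r a a'' ≤ r a a' + r a' a'') (s : GaugeConfig 3 M G)
    {f : GaugeConfig 3 (b * M) G → ℝ} {Δ : Finset (Edge 3 (b * M))} {δ : Edge 3 (b * M) → ℝ}
    (hdep : DependsOn f (↑Δ : Set (Edge 3 (b * M)))) (hδ : IsLipBound r f δ) :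
    IsLipBound r (fixPull b M s f) (fixLoad b M Δ δ) := by
  classical
  refine ⟨fixLoad_nonneg Δ hδ.nonneg, fun e₀ U U' hUU' => ?_⟩
  set A := gaugeTransform (leafGauge b M s) (forestFix b M U) with hA
  set A' := gaugeTransform (leafGauge b M s) (forestFix b M U') with hA'
  have hr0 := weight_nonneg hsymm hself htri
  have hedge : ∀ e : Edge 3 (b * M), r (A e) (A' e) ≤
      ((if e = e₀ then 1 else 0) + starReads b M e₀ e.1 + starReads b M e₀ (e.1.shift e.2)) * r (U e₀) (U' e₀) := by
    intro e
    have hown : r (U e) (U' e) ≤ (if e = e₀ then 1 else 0) * r (U e₀) (U' e₀) := by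
      by_cases he : e = e₀
      · subst he; rw [if_pos rfl, one_mul]
      · rw [if_neg he, hUU' e he, hself, zero_mul]
    calc r (A e) (A' e) = r (forestFix b M U e) (forestFix b M U' e) := weight_gaugeTransform_eq hmulL hmulR _ _ _ e
      _ ≤ r (forestFix b M U e) (gaugeTransform (leafGauge b M (starDecimation b M U)⁻¹) U' e)
          + r (gaugeTransform (leafGauge b M (starDecimation b M U)⁻¹) U' e) (forestFix b M U' e) := htri _ _ _
      _ ≤ (if e = e₀ then 1 else 0) * r (U e₀) (U' e₀)
          + (starReads b M e₀ e.1 * r (U e₀) (U' e₀) + starReads b M e₀ (e.1.shift e.2) * r (U e₀) (U' e₀)) := by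
          refine add_le_add ?_ ?_
          · exact (weight_gaugeTransform_eq hmulL hmulR _ U U' e).le.trans hown
          · exact (weight_gaugeTransform_leafGauge_le hmulL hmulR hsymm htri _ _ U' e).trans
              (add_le_add (weight_leafGauge_starDecimation_le hb hsymm hself htri hUU' _)
                (weight_leafGauge_starDecimation_le hb hsymm hself htri hUU' _))
      _ = _ := by ring
  calc |fixPull b M s f U - fixPull b M s f U'| = |f A - f A'| := rfl
    _ ≤ ∑ e ∈ Δ, δ e * r (A e) (A' e) := abs_sub_le_sum_of_dependsOn hdep hδ A A'
    _ ≤ ∑ e ∈ Δ, δ e * (((if e = e₀ then 1 else 0) + starReads b M e₀ e.1 + starReads b M e₀ (e.1.shift e.2))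
          * r (U e₀) (U' e₀)) := Finset.sum_le_sum fun e _ => mul_le_mul_of_nonneg_left (hedge e) (hδ.nonneg e)
    _ = fixLoad b M Δ δ e₀ * r (U e₀) (U' e₀) := by
          rw [fixLoad, Finset.sum_mul]; exact Finset.sum_congr rfl fun e _ => by ring

/-- A leaf is adjacent to the base point of the star link it reads. [folklore] -/
theorem torusNorm_sub_liftSite_le_one_of_leafLink (hb : 0 < b) {x : Site 3 (b * M)} {c : Edge 3 M}
    (h : leafLink b M x = some c) :
    Literature.MathematicalPhysics.QuantumFieldTheory.torusNorm (x - liftSite b M c.1) ≤ 1 := by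
  classical
  haveI : NeZero (b * M) := ⟨Nat.mul_ne_zero hb.ne' (NeZero.ne M)⟩
  unfold leafLink at h
  by_cases hx : ∃ i : Fin 3, (x i).val % b = 1 ∧ ∀ j, j ≠ i → (x j).val % b = 0
  · rw [dif_pos hx] at h
    have hc : c.1 = blockOf b M x := by rw [← Option.some.inj h]
    refine Finset.sup_le fun j _ => ?_
    have hj : (x - liftSite b M c.1) j = (((x j).val % b : ℕ) : ZMod (b * M)) := by
      rw [hc]
      have hdiv : (x j).val / b < M := Nat.div_lt_of_lt_mul (ZMod.val_lt (x j))
      simp only [Pi.sub_apply, liftSite, blockOf, ZMod.val_natCast, Nat.mod_eq_of_lt hdiv]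
      rw [sub_eq_iff_eq_add, ← Nat.cast_add, Nat.mod_add_div, ZMod.natCast_zmod_val]
    rw [hj]
    rcases hx with ⟨i, hi, hrest⟩
    by_cases hji : j = i
    · rw [hji, hi, Nat.cast_one]; exact natAbs_valMinAbs_one_le_one
    · rw [hrest j hji, Nat.cast_zero, ZMod.valMinAbs_zero]; norm_num
  · rw [dif_neg hx] at h; exact absurd h (by simp)

/-- Every link of the enlarged support is based within torus distance `2` of the base point of a link of `Δ`. [folklore] -/
theorem exists_near_of_mem_fixSupport (hb : 0 < b) {Δ : Set (Edge 3 (b * M))} {e₀ : Edge 3 (b * M)}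
    (h : e₀ ∈ fixSupport b M Δ) :
    ∃ e ∈ Δ, Literature.MathematicalPhysics.QuantumFieldTheory.torusNorm (e₀.1 - e.1) ≤ 2 := by
  haveI : NeZero (b * M) := ⟨Nat.mul_ne_zero hb.ne' (NeZero.ne M)⟩
  rcases h with h | ⟨e, he, c, hc, rfl⟩
  · exact ⟨e₀, h, by rw [sub_self, Literature.MathematicalPhysics.QuantumFieldTheory.torusNorm_zero]; norm_num⟩
  · refine ⟨e, he, ?_⟩
    rcases hc with hc | hc
    · have h1 := torusNorm_sub_liftSite_le_one_of_leafLink hb hc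
      rw [← Literature.MathematicalPhysics.QuantumFieldTheory.torusNorm_neg, neg_sub] at h1
      exact h1.trans (by norm_num)
    · have h1 := torusNorm_sub_liftSite_le_one_of_leafLink hb hc
      rw [← Literature.MathematicalPhysics.QuantumFieldTheory.torusNorm_neg, neg_sub] at h1
      have h2 := torusNorm_shift_sub_le_one e.1 e.2
      have h3 := Literature.MathematicalPhysics.QuantumFieldTheory.torusNorm_sub_le
        (liftSite b M c.1) (e.1.shift e.2) e.1
      show Literature.MathematicalPhysics.QuantumFieldTheory.torusNorm (liftSite b M c.1 - e.1) ≤ 2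
      omega

/-- **SEPARATION LOSS ≤ 4**: enlarged supports of sets at torus separation `≥ n` are at separation `≥ n − 4`. [folklore] -/
theorem fixSupport_separated (hb : 0 < b) {Δf Δg : Set (Edge 3 (b * M))} {n : ℕ}
    (hsep : ∀ x ∈ Δf, ∀ y ∈ Δg, n ≤ Literature.MathematicalPhysics.QuantumFieldTheory.torusNorm (x.1 - y.1))
    {x y : Edge 3 (b * M)} (hx : x ∈ fixSupport b M Δf) (hy : y ∈ fixSupport b M Δg) :
    n - 4 ≤ Literature.MathematicalPhysics.QuantumFieldTheory.torusNorm (x.1 - y.1) := by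
  obtain ⟨e, he, hxe⟩ := exists_near_of_mem_fixSupport hb hx
  obtain ⟨e', he', hye⟩ := exists_near_of_mem_fixSupport hb hy
  have h := hsep e he e' he'
  have h1 := Literature.MathematicalPhysics.QuantumFieldTheory.torusNorm_sub_le e.1 x.1 e'.1
  have h2 := Literature.MathematicalPhysics.QuantumFieldTheory.torusNorm_sub_le x.1 y.1 e'.1
  rw [← Literature.MathematicalPhysics.QuantumFieldTheory.torusNorm_neg, neg_sub] at hxe
  omega

end ForestTransport

end Summit.Ventures.YMGap.YM3IR

end
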